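import Mathlib.Analysis.ODE.Gronwall
import Mathlib.Topology.Order.IntermediateValue
import Literature.Analysis.FluidPDE.CompressibleEulerImplosionUniqueness
import HarnessLib

/-!
# Buckmaster–Cao-Labora–Gómez-Serrano at γ = 5/3: continuous dependence on `r` (the tube estimate)

The analytic core of the shooting argument of §6 of the paper ("by continuity of the solution
with respect to the parameter `r`"): two solutions `f` (for `r₀`) and `g` (for `r`) of the
autonomous system (1.8), `c′ = field r c`, which start close at time `a`, stay close on a time
interval `[a, T]` on which `f` keeps a definite distance from the sonic lines — quantitatively,
by Grönwall's inequality (`dist_le_of_approx_trajectories_ODE_of_mem` of Mathlib) applied on the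
slab `{D_W ≥ m, D_Z ≤ −m, |W|, |Z| ≤ R}`, on which the field is Lipschitz with an explicit
constant and depends Lipschitz-continuously on `r` (`field_lipschitzOnWith`, `dist_field_le`),
combined with a bootstrap (real induction) keeping `g` inside the slab; in particular `g` cannot
reach the sonic point before time `T` (`tube_estimate`).

[cite: BuckmasterCaolaboraGomezserrano2025, §6 (proof of Theorem 1.1), Prop. 4.1]
-/

noncomputable section

open Set Filter Topology NNReal

namespace Literature.Analysis.FluidPDE

namespace BuckmasterCaolaboraGomezserrano2025

namespace Monatomic

namespace Tube

/-! ### The slab and elementary bounds -/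

/-- The slab `{D_W ≥ m, D_Z ≤ −m, |W| ≤ R, |Z| ≤ R}`. [folklore] -/
def slab (m R : ℝ) : Set (ℝ × ℝ) := {p | m ≤ DW p.1 p.2 ∧ DZ p.1 p.2 ≤ -m ∧ |p.1| ≤ R ∧ |p.2| ≤ R}

/-- [folklore] -/
theorem mem_slab {m R : ℝ} {p : ℝ × ℝ} :
    p ∈ slab m R ↔ m ≤ DW p.1 p.2 ∧ DZ p.1 p.2 ≤ -m ∧ |p.1| ≤ R ∧ |p.2| ≤ R := Iff.rfl

/-- `|a/b − a'/b'| ≤ A/m + N D/m²` from `|b|, |b'| ≥ m`. [folklore] -/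
theorem abs_div_sub_div_le {a a' b b' m A N D : ℝ} (hm : 0 < m) (hb : m ≤ |b|) (hb' : m ≤ |b'|)
    (hA : |a - a'| ≤ A) (hN : |a'| ≤ N) (hD : |b - b'| ≤ D) :
    |a / b - a' / b'| ≤ A / m + N * D / m ^ 2 := by
  have hb0 : b ≠ 0 := fun h => by rw [h, abs_zero] at hb; linarith
  have hb0' : b' ≠ 0 := fun h => by rw [h, abs_zero] at hb'; linarith
  have hA0 : 0 ≤ A := (abs_nonneg _).trans hA
  have hN0 : 0 ≤ N := (abs_nonneg _).trans hN
  have hD0 : 0 ≤ D := (abs_nonneg _).trans hD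
  have e : a / b - a' / b' = (a - a') / b + a' * (b' - b) / (b * b') := by
    field_simp; ring
  rw [e]
  refine (abs_add_le _ _).trans (add_le_add ?_ ?_)
  · rw [abs_div]
    exact div_le_div₀ hA0 hA hm hb
  · rw [abs_div, abs_mul, abs_mul, abs_sub_comm]
    have hbb : m ^ 2 ≤ |b| * |b'| := by nlinarith [abs_nonneg b, abs_nonneg b']
    exact div_le_div₀ (by positivity) (mul_le_mul hN hD (abs_nonneg _) hN0) (by positivity) hbb

variable {r r' m R : ℝ}

/-- `|N_W| ≤ 4R²` on `|W|, |Z| ≤ R`, `R ≥ 1`, `|r| ≤ 2`. [folklore] -/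
theorem abs_NW_le (hr : |r| ≤ 2) (hR : 1 ≤ R) {W Z : ℝ} (hW : |W| ≤ R) (hZ : |Z| ≤ R) :
    |NW r W Z| ≤ 4 * R ^ 2 := by
  obtain ⟨hr1, hr2⟩ := abs_le.mp hr
  obtain ⟨hW1, hW2⟩ := abs_le.mp hW
  obtain ⟨hZ1, hZ2⟩ := abs_le.mp hZ
  unfold NW
  rw [abs_le]
  constructor <;> nlinarith [mul_nonneg (sub_nonneg.mpr hW2) (sub_nonneg.mpr hZ2),
    mul_nonneg (sub_nonneg.mpr hW2) (neg_le_iff_add_nonneg'.mp hZ1),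
    mul_nonneg (neg_le_iff_add_nonneg'.mp hW1) (sub_nonneg.mpr hZ2),
    mul_nonneg (neg_le_iff_add_nonneg'.mp hW1) (neg_le_iff_add_nonneg'.mp hZ1),
    mul_nonneg (sub_nonneg.mpr hW2) (neg_le_iff_add_nonneg'.mp hW1),
    mul_nonneg (sub_nonneg.mpr hZ2) (neg_le_iff_add_nonneg'.mp hZ1),
    mul_nonneg (sub_nonneg.mpr hr2) (sub_nonneg.mpr hW2),
    mul_nonneg (sub_nonneg.mpr hr2) (neg_le_iff_add_nonneg'.mp hW1),
    mul_nonneg (neg_le_iff_add_nonneg'.mp hr1) (sub_nonneg.mpr hW2),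
    mul_nonneg (neg_le_iff_add_nonneg'.mp hr1) (neg_le_iff_add_nonneg'.mp hW1)]

/-- `|N_Z| ≤ 4R²` on `|W|, |Z| ≤ R`, `R ≥ 1`, `|r| ≤ 2`. [folklore] -/
theorem abs_NZ_le (hr : |r| ≤ 2) (hR : 1 ≤ R) {W Z : ℝ} (hW : |W| ≤ R) (hZ : |Z| ≤ R) :
    |NZ r W Z| ≤ 4 * R ^ 2 := by
  have h := abs_NW_le hr hR hZ hW
  have e : NZ r W Z = NW r Z W := by unfold NZ NW; ring
  rw [e]; exact h

/-- Lipschitz estimate of `N_W` in the sup distance. [folklore] -/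
theorem abs_NW_sub_le (hr : |r| ≤ 2) {W Z W' Z' d : ℝ} (hW : |W| ≤ R) (hZ : |Z| ≤ R)
    (hW' : |W'| ≤ R) (hZ' : |Z'| ≤ R) (hdW : |W - W'| ≤ d) (hdZ : |Z - Z'| ≤ d) :
    |NW r W Z - NW r W' Z'| ≤ (2 + 3 * R) * d := by
  have hd : 0 ≤ d := (abs_nonneg _).trans hdW
  have hR : 0 ≤ R := (abs_nonneg _).trans hW
  obtain ⟨hr1, hr2⟩ := abs_le.mp hr
  obtain ⟨hW1, hW2⟩ := abs_le.mp hW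
  obtain ⟨hZ1, hZ2⟩ := abs_le.mp hZ
  obtain ⟨hW1', hW2'⟩ := abs_le.mp hW'
  obtain ⟨hZ1', hZ2'⟩ := abs_le.mp hZ'
  have e : NW r W Z - NW r W' Z' = (W - W') * (-r - 5 / 6 * (W + W') - Z / 3)
      + (Z - Z') * (-W' / 3 + (Z + Z') / 6) := by unfold NW; ring
  rw [e]
  have h1 : |-r - 5 / 6 * (W + W') - Z / 3| ≤ 2 + 2 * R := abs_le.mpr ⟨by linarith, by linarith⟩
  have h2 : |-W' / 3 + (Z + Z') / 6| ≤ R := abs_le.mpr ⟨by linarith, by linarith⟩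
  calc |(W - W') * (-r - 5 / 6 * (W + W') - Z / 3) + (Z - Z') * (-W' / 3 + (Z + Z') / 6)|
      ≤ |W - W'| * |-r - 5 / 6 * (W + W') - Z / 3| + |Z - Z'| * |-W' / 3 + (Z + Z') / 6| := by
        refine (abs_add_le _ _).trans ?_; rw [abs_mul, abs_mul]
    _ ≤ d * (2 + 2 * R) + d * R := by gcongr
    _ = (2 + 3 * R) * d := by ring

/-- Lipschitz estimate of `N_Z` in the sup distance. [folklore] -/
theorem abs_NZ_sub_le (hr : |r| ≤ 2) {W Z W' Z' d : ℝ} (hW : |W| ≤ R) (hZ : |Z| ≤ R)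
    (hW' : |W'| ≤ R) (hZ' : |Z'| ≤ R) (hdW : |W - W'| ≤ d) (hdZ : |Z - Z'| ≤ d) :
    |NZ r W Z - NZ r W' Z'| ≤ (2 + 3 * R) * d := by
  have h := abs_NW_sub_le hr hZ hW hZ' hW' hdZ hdW
  have e : NZ r W Z - NZ r W' Z' = NW r Z W - NW r Z' W' := by unfold NZ NW; ring
  rw [e]; exact h

/-- [folklore] -/
theorem abs_DW_sub_le {W Z W' Z' d : ℝ} (hdW : |W - W'| ≤ d) (hdZ : |Z - Z'| ≤ d) :
    |DW W Z - DW W' Z'| ≤ d := by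
  have e : DW W Z - DW W' Z' = (2 * (W - W') + (Z - Z')) / 3 := by unfold DW; ring
  rw [e, abs_div, abs_of_pos (by norm_num : (0:ℝ) < 3), div_le_iff₀ (by norm_num : (0:ℝ) < 3)]
  calc |2 * (W - W') + (Z - Z')| ≤ |2 * (W - W')| + |Z - Z'| := abs_add_le _ _
    _ = 2 * |W - W'| + |Z - Z'| := by rw [abs_mul, abs_two]
    _ ≤ d * 3 := by linarith

/-- [folklore] -/
theorem abs_DZ_sub_le {W Z W' Z' d : ℝ} (hdW : |W - W'| ≤ d) (hdZ : |Z - Z'| ≤ d) :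
    |DZ W Z - DZ W' Z'| ≤ d := by
  have e : DZ W Z - DZ W' Z' = ((W - W') + 2 * (Z - Z')) / 3 := by unfold DZ; ring
  rw [e, abs_div, abs_of_pos (by norm_num : (0:ℝ) < 3), div_le_iff₀ (by norm_num : (0:ℝ) < 3)]
  calc |(W - W') + 2 * (Z - Z')| ≤ |W - W'| + |2 * (Z - Z')| := abs_add_le _ _
    _ = |W - W'| + 2 * |Z - Z'| := by rw [abs_mul, abs_two]
    _ ≤ d * 3 := by linarith

/-- The Lipschitz constant of the field on the slab. [folklore] -/
def Klip (m R : ℝ) : ℝ := (2 + 3 * R) / m + 4 * R ^ 2 * 1 / m ^ 2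

/-- [folklore] -/
theorem Klip_nonneg (hm : 0 < m) (hR : 1 ≤ R) : 0 ≤ Klip m R := by
  unfold Klip; positivity

/-- **The field is Lipschitz on the slab** (sup distance, explicit constant).
[cite: BuckmasterCaolaboraGomezserrano2025, §6] -/
theorem dist_field_field_le (hr : |r| ≤ 2) (hm : 0 < m) (hR : 1 ≤ R) {p p' : ℝ × ℝ}
    (hp : p ∈ slab m R) (hp' : p' ∈ slab m R) :
    dist (field r p) (field r p') ≤ Klip m R * dist p p' := by
  obtain ⟨hDW, hDZ, hW, hZ⟩ := hp
  obtain ⟨hDW', hDZ', hW', hZ'⟩ := hp'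
  set d := dist p p' with hd
  have hdW : |p.1 - p'.1| ≤ d := by rw [← Real.dist_eq, hd, Prod.dist_eq]; exact le_max_left _ _
  have hdZ : |p.2 - p'.2| ≤ d := by rw [← Real.dist_eq, hd, Prod.dist_eq]; exact le_max_right _ _
  have hd0 : 0 ≤ d := dist_nonneg
  have habsDW : m ≤ |DW p.1 p.2| := hDW.trans (le_abs_self _)
  have habsDW' : m ≤ |DW p'.1 p'.2| := hDW'.trans (le_abs_self _)
  have habsDZ : m ≤ |DZ p.1 p.2| := by rw [abs_of_neg (by linarith)]; linarith
  have habsDZ' : m ≤ |DZ p'.1 p'.2| := by rw [abs_of_neg (by linarith)]; linarith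
  have h1 := abs_div_sub_div_le hm habsDW habsDW' (abs_NW_sub_le hr hW hZ hW' hZ' hdW hdZ)
    (abs_NW_le hr hR hW' hZ') (abs_DW_sub_le hdW hdZ)
  have h2 := abs_div_sub_div_le hm habsDZ habsDZ' (abs_NZ_sub_le hr hW hZ hW' hZ' hdW hdZ)
    (abs_NZ_le hr hR hW' hZ') (abs_DZ_sub_le hdW hdZ)
  have hK : (2 + 3 * R) * d / m + 4 * R ^ 2 * d / m ^ 2 = Klip m R * d := by unfold Klip; ring
  rw [Prod.dist_eq, Real.dist_eq, Real.dist_eq]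
  refine max_le ?_ ?_
  · show |NW r p.1 p.2 / DW p.1 p.2 - NW r p'.1 p'.2 / DW p'.1 p'.2| ≤ _
    rw [← hK]; exact h1
  · show |NZ r p.1 p.2 / DZ p.1 p.2 - NZ r p'.1 p'.2 / DZ p'.1 p'.2| ≤ _
    rw [← hK]; exact h2

/-- `LipschitzOnWith` form. [cite: BuckmasterCaolaboraGomezserrano2025, §6] -/
theorem field_lipschitzOnWith (hr : |r| ≤ 2) (hm : 0 < m) (hR : 1 ≤ R) :
    LipschitzOnWith (Real.toNNReal (Klip m R)) (field r) (slab m R) :=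
  LipschitzOnWith.of_dist_le_mul fun p hp p' hp' => by
    rw [Real.coe_toNNReal _ (Klip_nonneg hm hR)]
    exact dist_field_field_le hr hm hR hp hp'

/-- **Dependence of the field on `r`** on the slab: `‖field r p − field r' p‖ ≤ |r − r'| R/m`.
[cite: BuckmasterCaolaboraGomezserrano2025, §6] -/
theorem dist_field_le (hm : 0 < m) {p : ℝ × ℝ} (hp : p ∈ slab m R) :
    dist (field r p) (field r' p) ≤ |r - r'| * (R / m) := by
  obtain ⟨hDW, hDZ, hW, hZ⟩ := hp
  have hR : 0 ≤ R := (abs_nonneg _).trans hW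
  have hDWpos : 0 < DW p.1 p.2 := by linarith
  have hDZneg : DZ p.1 p.2 < 0 := by linarith
  rw [Prod.dist_eq, Real.dist_eq, Real.dist_eq]
  refine max_le ?_ ?_
  · show |NW r p.1 p.2 / DW p.1 p.2 - NW r' p.1 p.2 / DW p.1 p.2| ≤ _
    have e : NW r p.1 p.2 / DW p.1 p.2 - NW r' p.1 p.2 / DW p.1 p.2 = -(r - r') * p.1 / DW p.1 p.2 := by
      unfold NW; field_simp; ring
    rw [e, abs_div, abs_mul, abs_neg, abs_of_pos hDWpos, div_le_iff₀ hDWpos]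
    calc |r - r'| * |p.1| ≤ |r - r'| * R := by gcongr
      _ = |r - r'| * (R / m) * m := by field_simp
      _ ≤ |r - r'| * (R / m) * DW p.1 p.2 := by gcongr
  · show |NZ r p.1 p.2 / DZ p.1 p.2 - NZ r' p.1 p.2 / DZ p.1 p.2| ≤ _
    have e : NZ r p.1 p.2 / DZ p.1 p.2 - NZ r' p.1 p.2 / DZ p.1 p.2 = -(r - r') * p.2 / DZ p.1 p.2 := by
      unfold NZ; field_simp; ring
    rw [e, abs_div, abs_mul, abs_neg, abs_of_neg hDZneg, div_le_iff₀ (by linarith : 0 < -DZ p.1 p.2)]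
    calc |r - r'| * |p.2| ≤ |r - r'| * R := by gcongr
      _ = |r - r'| * (R / m) * m := by field_simp
      _ ≤ |r - r'| * (R / m) * (-DZ p.1 p.2) := by gcongr; linarith

/-- **The tube lies in the slab**: a point within sup-distance `η ≤ min(m, 1)` of a point with
`D_W ≥ 2m`, `D_Z ≤ −2m`, `|W|, |Z| ≤ R − 1` is in the slab. [folklore] -/
theorem mem_slab_of_dist_le {η : ℝ} (hηm : η ≤ m) (hη1 : η ≤ 1) {q p : ℝ × ℝ}
    (hq : 2 * m ≤ DW q.1 q.2 ∧ DZ q.1 q.2 ≤ -2 * m ∧ |q.1| ≤ R - 1 ∧ |q.2| ≤ R - 1)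
    (hd : dist q p ≤ η) : p ∈ slab m R := by
  obtain ⟨hDW, hDZ, hW, hZ⟩ := hq
  have hd' := hd
  rw [Prod.dist_eq, max_le_iff, Real.dist_eq, Real.dist_eq] at hd'
  have hdW : |q.1 - p.1| ≤ η := hd'.1
  have hdZ : |q.2 - p.2| ≤ η := hd'.2
  have h1 := abs_DW_sub_le hdW hdZ
  have h2 := abs_DZ_sub_le hdW hdZ
  obtain ⟨h1a, h1b⟩ := abs_le.mp h1
  obtain ⟨h2a, h2b⟩ := abs_le.mp h2
  obtain ⟨hwa, hwb⟩ := abs_le.mp hdW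
  obtain ⟨hza, hzb⟩ := abs_le.mp hdZ
  obtain ⟨hWa, hWb⟩ := abs_le.mp hW
  obtain ⟨hZa, hZb⟩ := abs_le.mp hZ
  refine ⟨by linarith, by linarith, abs_le.mpr ⟨by linarith, by linarith⟩, abs_le.mpr ⟨by linarith, by linarith⟩⟩

/-! ### The tube estimate -/

/-- **Continuous dependence on `r` (tube estimate).** Let `f` solve `c′ = field r₀ c` on
`(−∞, b_f)` and `g` solve `c′ = field r c` on `(−∞, b_g)` with `g → P` as `t → b_g⁻`, `D_Z(P) = 0`
(`g` ends on the sonic line, as the `P₀` trajectories do at `P_s`). Suppose that on `[a, T]`,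
`T < b_f`, `a < b_g`, the curve `f` satisfies `D_W ≥ 2m`, `D_Z ≤ −2m`, `|W|, |Z| ≤ R − 1`, and that
the Grönwall bound built from the initial distance, the Lipschitz constant of the slab and the size
`|r − r₀| R/m` of the perturbation is `< η ≤ min(m, 1)` at time `T`. Then `b_g > T` and
`dist(f, g)` obeys the Grönwall bound on `[a, T]`. [cite: BuckmasterCaolaboraGomezserrano2025, §6] -/
theorem tube_estimate {r r0 : ℝ} {f g : ℝ → ℝ × ℝ} {a T bf bg m R η : ℝ} {P : ℝ × ℝ}
    (hr0 : |r0| ≤ 2) (haT : a ≤ T) (hTf : T < bf) (hag : a < bg)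
    (hf : ∀ t ∈ Iio bf, HasDerivAt f (field r0 (f t)) t)
    (hg : ∀ t ∈ Iio bg, HasDerivAt g (field r (g t)) t)
    (hglim : Tendsto g (𝓝[<] bg) (𝓝 P)) (hP : DZ P.1 P.2 = 0)
    (hm : 0 < m) (hR : 1 ≤ R) (hη : 0 < η) (hηm : η ≤ m) (hη1 : η ≤ 1)
    (hfs : ∀ t ∈ Icc a T, 2 * m ≤ DW (f t).1 (f t).2 ∧ DZ (f t).1 (f t).2 ≤ -2 * m ∧
      |(f t).1| ≤ R - 1 ∧ |(f t).2| ≤ R - 1)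
    (hbound : gronwallBound (dist (f a) (g a)) (Klip m R) (|r - r0| * (R / m)) (T - a) < η) :
    T < bg ∧ ∀ t ∈ Icc a T,
      dist (f t) (g t) ≤ gronwallBound (dist (f a) (g a)) (Klip m R) (|r - r0| * (R / m)) (t - a) := by
  set δ0 := dist (f a) (g a) with hδ0
  set K := Klip m R with hK
  set ε := |r - r0| * (R / m) with hε
  have hK0 : 0 ≤ K := Klip_nonneg hm hR
  have hε0 : 0 ≤ ε := by positivity
  have hδ00 : 0 ≤ δ0 := dist_nonneg
  have hmono := gronwallBound_mono hδ00 hε0 hK0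
  -- Grönwall on `[a, t₁]` given closeness (hence slab membership of `g`) on `[a, t₁]`
  have gron : ∀ t₁, t₁ ≤ T → t₁ < bg → (∀ u ∈ Icc a t₁, dist (f u) (g u) ≤ η) →
      ∀ t ∈ Icc a t₁, dist (f t) (g t) ≤ gronwallBound δ0 K ε (t - a) := by
    intro t₁ ht₁T ht₁g hclose t ht
    have hfc : ContinuousOn f (Icc a t₁) := fun u hu =>
      (hf u (lt_of_le_of_lt (hu.2.trans ht₁T) hTf)).continuousAt.continuousWithinAt
    have hgc : ContinuousOn g (Icc a t₁) := fun u hu =>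
      (hg u (lt_of_le_of_lt hu.2 ht₁g)).continuousAt.continuousWithinAt
    have key := dist_le_of_approx_trajectories_ODE_of_mem
      (v := fun _ p => field r0 p) (s := fun _ => slab m R) (K := Real.toNNReal K)
      (f := f) (g := g) (f' := fun u => field r0 (f u)) (g' := fun u => field r (g u))
      (a := a) (b := t₁) (εf := 0) (εg := ε) (δ := δ0)
      (fun u _ => field_lipschitzOnWith hr0 hm hR)
      hfc (fun u hu => (hf u ((hu.2.trans_le ht₁T).trans hTf)).hasDerivWithinAt)
      (fun u _ => by rw [dist_self])
      (fun u hu => by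
        have h := hfs u ⟨hu.1, hu.2.le.trans ht₁T⟩
        exact mem_slab_of_dist_le hηm hη1 h (by rw [dist_self]; exact hη.le))
      hgc (fun u hu => (hg u (hu.2.trans ht₁g)).hasDerivWithinAt)
      (fun u hu => by
        have h := hfs u ⟨hu.1, hu.2.le.trans ht₁T⟩
        have hmem := mem_slab_of_dist_le hηm hη1 h (hclose u ⟨hu.1, hu.2.le⟩)
        rw [dist_comm]
        have := dist_field_le (r := r0) (r' := r) hm hmem
        rwa [abs_sub_comm] at this)
      (fun u hu => by
        have h := hfs u ⟨hu.1, hu.2.le.trans ht₁T⟩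
        exact mem_slab_of_dist_le hηm hη1 h (hclose u ⟨hu.1, hu.2.le⟩))
      le_rfl t ht
    rw [Real.coe_toNNReal _ hK0, zero_add] at key
    exact key
  -- the bootstrap: `A` = times up to which `g` is defined and `η`-close to `f`
  set A : Set ℝ := {t | t ∈ Icc a T ∧ t < bg ∧ ∀ u ∈ Icc a t, dist (f u) (g u) ≤ η} with hA
  have hδη : δ0 < η := by
    have := hmono (sub_nonneg.mpr haT)
    rw [gronwallBound_x0] at this
    exact this.trans_lt hbound
  have haA : a ∈ A := by
    refine ⟨⟨le_rfl, haT⟩, hag, fun u hu => ?_⟩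
    have : u = a := le_antisymm hu.2 hu.1
    rw [this]; exact hδη.le
  have hAbdd : BddAbove A := ⟨T, fun t ht => ht.1.2⟩
  have hAne : A.Nonempty := ⟨a, haA⟩
  set τ := sSup A with hτ
  have haτ : a ≤ τ := le_csSup hAbdd haA
  have hτT : τ ≤ T := csSup_le hAne fun t ht => ht.1.2
  -- `A` is an initial segment
  have hdown : ∀ t ∈ A, ∀ t', a ≤ t' → t' ≤ t → t' ∈ A := fun t ht t' h1 h2 =>
    ⟨⟨h1, h2.trans ht.1.2⟩, lt_of_le_of_lt h2 ht.2.1, fun u hu => ht.2.2 u ⟨hu.1, hu.2.trans h2⟩⟩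
  have hbelow : ∀ t, a ≤ t → t < τ → t ∈ A := by
    intro t hat htτ
    obtain ⟨t', ht'A, htt'⟩ := exists_lt_of_lt_csSup hAne htτ
    exact hdown t' ht'A t hat htt'.le
  -- closeness below `τ`
  have hclose_lt : ∀ u, a ≤ u → u < τ → dist (f u) (g u) ≤ η := fun u hau huτ =>
    (hbelow u hau huτ).2.2 u ⟨hau, le_rfl⟩
  -- Step: `τ < bg`
  have hτg : τ < bg := by
    by_contra hcon
    push Not at hcon
    -- closeness on `[a, bg)`, pass to the limit `t → bg⁻`
    have hbgT : bg ≤ T := hcon.trans hτT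
    have hfcont : ContinuousAt f bg := (hf bg (lt_of_le_of_lt hbgT hTf)).continuousAt
    have hlimf : Tendsto f (𝓝[<] bg) (𝓝 (f bg)) := hfcont.tendsto.mono_left nhdsWithin_le_nhds
    have hlimd : Tendsto (fun u => dist (f u) (g u)) (𝓝[<] bg) (𝓝 (dist (f bg) P)) :=
      hlimf.dist hglim
    have hev : ∀ᶠ u in 𝓝[<] bg, dist (f u) (g u) ≤ η := by
      filter_upwards [Ioo_mem_nhdsLT hag] with u hu
      exact hclose_lt u hu.1.le (lt_of_lt_of_le hu.2 hcon)
    have hle : dist (f bg) P ≤ η := le_of_tendsto hlimd hev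
    have hmem := mem_slab_of_dist_le hηm hη1 (hfs bg ⟨hag.le, hbgT⟩) hle
    have := hmem.2.1
    rw [hP] at this
    linarith
  -- Step: `τ ∈ A`
  have hτA : τ ∈ A := by
    refine ⟨⟨haτ, hτT⟩, hτg, fun u hu => ?_⟩
    rcases lt_or_eq_of_le hu.2 with hlt | heq
    · exact hclose_lt u hu.1 hlt
    · rw [heq]
      rcases eq_or_lt_of_le haτ with hat | hat
      · rw [← hat]; exact hδη.le
      · -- limit from the left at `τ`
        have hfcont : ContinuousAt f τ := (hf τ (lt_of_le_of_lt hτT hTf)).continuousAt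
        have hgcont : ContinuousAt g τ := (hg τ hτg).continuousAt
        have hlimd : Tendsto (fun u => dist (f u) (g u)) (𝓝[<] τ) (𝓝 (dist (f τ) (g τ))) :=
          (hfcont.tendsto.dist hgcont.tendsto).mono_left nhdsWithin_le_nhds
        have hev : ∀ᶠ u in 𝓝[<] τ, dist (f u) (g u) ≤ η := by
          filter_upwards [Ioo_mem_nhdsLT hat] with u hu
          exact hclose_lt u hu.1.le hu.2
        exact le_of_tendsto hlimd hev
  -- Step: `τ = T`
  have hτeq : τ = T := by
    by_contra hne
    have hlt : τ < T := lt_of_le_of_ne hτT hne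
    -- Grönwall up to `τ` gives `dist < η` at `τ`, hence a bit beyond
    have hgr := gron τ hτT hτg hτA.2.2 τ ⟨haτ, le_rfl⟩
    have hltη : dist (f τ) (g τ) < η :=
      hgr.trans_lt ((hmono (by linarith : τ - a ≤ T - a)).trans_lt hbound)
    have hfcont : ContinuousAt f τ := (hf τ (lt_of_le_of_lt hτT hTf)).continuousAt
    have hgcont : ContinuousAt g τ := (hg τ hτg).continuousAt
    have hcd : ContinuousAt (fun u => dist (f u) (g u)) τ := hfcont.dist hgcont
    have hev : ∀ᶠ u in 𝓝 τ, dist (f u) (g u) < η := hcd.eventually (gt_mem_nhds hltη)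
    have hev2 : ∀ᶠ u in 𝓝 τ, u < bg := (isOpen_Iio.mem_nhds hτg)
    have hev3 : ∀ᶠ u in 𝓝 τ, u < T := (isOpen_Iio.mem_nhds hlt)
    obtain ⟨ε', hε', hball⟩ := Metric.eventually_nhds_iff.mp (hev.and (hev2.and hev3))
    set t' := τ + ε' / 2 with ht'
    have ht'τ : τ < t' := by simp only [ht']; linarith
    have hdist' : ∀ u, τ ≤ u → u ≤ t' → dist (f u) (g u) < η ∧ u < bg ∧ u < T := by
      intro u h1 h2
      apply hball
      rw [Real.dist_eq, abs_lt]; constructor <;> simp only [ht'] at h2 <;> linarith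
    have ht'A : t' ∈ A := by
      obtain ⟨_, h2, h3⟩ := hdist' t' ht'τ.le le_rfl
      refine ⟨⟨haτ.trans ht'τ.le, h3.le⟩, h2, fun u hu => ?_⟩
      rcases lt_or_ge u τ with h | h
      · exact hclose_lt u hu.1 h
      · exact (hdist' u h hu.2).1.le
    have := le_csSup hAbdd ht'A
    linarith
  -- conclusion
  rw [hτeq] at hτA
  exact ⟨hτA.2.1, gron T le_rfl hτA.2.1 hτA.2.2⟩

end Tube

end Monatomic

end BuckmasterCaolaboraGomezserrano2025

end Literature.Analysis.FluidPDE
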